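import Literature.MathematicalPhysics.QuantumFieldTheory.Balaban1983to89.B1Sect1Statements
import Literature.MathematicalPhysics.QuantumFieldTheory.Balaban1983to89.HiggsActionIntegrable
import Literature.MathematicalPhysics.QuantumFieldTheory.Balaban1983to89.B1Ineq233Upper

/-!
# `Balaban1983to89.B1Eq113OneSidedDerivatives` — T. Bałaban, *(Higgs)₂,₃ quantum fields in a finite volume. I*,
# Commun. Math. Phys. **85** (1982) 603–626 [Balaban1982Higgs1]: the `λ`-derivatives at `λ = 0` in the vacuum-energy
# counterterm `E₁` (1.13) p. 606 are ONE-SIDED — what the typed carrier `B1Sect1Statements.ModelData.e1` denotes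
# under Lean's total-function conventions, and what the print denotes (theorems only)

statement-level skeleton of published theorems with citation tags; proofs where landed; nothing here is a claim about
the Yang–Mills mass gap

CITATION HEADER (lean-in-tree rule).  lit-balaban TYPED SKELETON, rows `B1.Eq1.13` (E₁; decl of record
`B1Sect1Statements.ModelData.e1`, r01 p239833), `B1.Eq1.9-1.10` / `B1.Eq1.11` (carriers `HiggsLattice.partitionFn` /
`HiggsLattice.action`, typer p239040) and the CONCRETE INSTANCE of `B1.Thm@606` (`B1Sect1Statements.Thm114`, whose
`Z^ε = ModelData.zRen` carries `E = E₀ + E₁` with this `E₁`); unit `lit-balaban-typer` gen 24 (a semantic audit of a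
decl of record; no file of another seat is touched; v1.1 = §5, append-only).  RELATION TO THE TREE (nothing restated): `HiggsLattice` defines
the action (1.11) `action C c A φ` and the partition function (1.10) `partitionFn` as a LEBESGUE (Bochner) integral
`∫ exp(−S^ε)` over `(bonds → ℝ) × (sites → ℝ^N)`; `HiggsActionIntegrable` (typer g3) proves `exp(−S^ε) ∈ L¹` and
`Z^ε > 0` under *"μ₀² > 0 and λ > 0"*; `B1Sect1Statements` (r01) defines `ModelData.zOf P e' λ' E` (the partition
function as a function of the couplings), `logZ P e' λ' = log (zOf P e' λ' 0)` and
`e1 P = Σ_{1≤α+β≤n̄} (α!β!)⁻¹ e^α λ^β · iteratedDeriv α (e' ↦ iteratedDeriv β (λ' ↦ logZ P e' λ') 0) 0` — the printed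
mixed partials of (1.13) as ITERATED TWO-SIDED one-variable derivatives (`iteratedDeriv`), with the file's own caveat
*"equal to the printed mixed partial for the smooth function log Z; smoothness is not asserted here"*.

WHAT THIS MODULE SHOWS (all PROVED; `N ≥ 1` scalar components throughout):
* §1 `not_integrable_exp_neg_action` — for a NEGATIVE quartic coupling `λ < 0` (any `m₀²`, `μ₀²`, `e`, `E`) the
  integrand `exp(−S^ε)` of (1.10) is NOT Lebesgue integrable (the exact converse side of typer g3's
  `integrable_exp_neg_action`): `S^ε(A, φ) ≤ S^ε(A, 0) + |T|·κ` (`action_le_action_zero_add`, the quartic term wins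
  sitewise, `covLaplaceForm_le` bounds the covariant kinetic form by `4dη⁻²Σ_x η^d|φ(x)|²`), so `exp(−S^ε)`
  dominates a positive function of `A` alone, whose integral over the infinite-volume fibre `sites → ℝ^N` diverges.
  Hence, by the Bochner convention `∫ f = 0` for non-integrable `f`, `partitionFn = 0` (`partitionFn_eq_zero_of_lam_neg`)
  and r01's `zOf P e' λ' E = 0`, `logZ P e' λ' = 0` for every `λ' < 0` (`zOf_eq_zero_of_neg`, `logZ_eq_zero_of_neg`).
* §2 (calculus, [folklore]) a real function vanishing on `(−∞, 0)` has two-sided `deriv` equal to `0` at `0`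
  — whether or not it is differentiable there (`deriv_eq_zero_of_eqOn_Iio`; Lean's `deriv` is `0` at points of
  non-differentiability, and a differentiable such function has derivative `0` by uniqueness of the derivative within
  `Iio 0`) — and likewise all `iteratedDeriv n`, `n ≥ 1` (`iteratedDeriv_eq_zero_of_eqOn_Iio`).
* §3 THE FINDING: for every `e'` and every `β ≥ 1`, `iteratedDeriv β (λ' ↦ logZ P e' λ') 0 = 0`
  (`iteratedDeriv_logZ_lam_eq_zero`); consequently `ModelData.e1 P` EQUALS its `β = 0` sub-sum
  `Σ_{1≤α≤n̄} (α!)⁻¹ e^α (d/de')^α log Z(e', 0)|₀` (`e1_eq_sum_beta_zero`): under Lean's conventions the typed `E₁`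
  contains NO `λ`-counterterm (no term of (1.13) with `β ≥ 1` survives), for every choice of the data `δm²`.
* §4 WHAT THE PRINT DENOTES is the RIGHT derivative at `λ = 0⁺` (p. 605: *"δm² is the counterterm given by a
  perturbation expansion in e and λ"*, p. 606: *"The constant E₁ is given again by a perturbation expansion"*; for
  `λ < 0` the integral (1.10) diverges in print as well): at the carrier level, with the bare mass held fixed,
  `m₀² > 0`, `μ₀² > 0`, the partition function `λ ↦ Z(λ) = partitionFn P k N C ⟨m₀², λ, μ₀², E⟩` HAS a right
  derivative at `0`, equal to minus the quartic moment `−∫ V(φ) exp(−S^ε_{λ=0}) dA dφ`, `V(φ) = Σ_x η^d|φ(x)|⁴`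
  (`hasDerivWithinAt_partitionFn_lam_Ici`; dominated convergence with `|λ⁻¹(e^{−λV} − 1)| ≤ V`, the moment
  `V·e^{−S₀}` being integrable — polynomial times Gaussian, `integrable_quartic_mul_exp`), the moment is `> 0`
  (`integral_quartic_mul_exp_pos`), so `d⁺/dλ log Z(λ)|₀ = −⟨V⟩₀` exists (`hasDerivWithinAt_log_partitionFn_lam_Ici`)
  and `derivWithin (λ ↦ log Z(λ)) (Ici 0) 0 < 0` (`derivWithin_log_partitionFn_lam_Ici_neg`) — whereas the two-sided
  `deriv (λ ↦ log Z(λ)) 0 = 0` (`deriv_log_partitionFn_lam_eq_zero`, `deriv_partitionFn_lam_eq_zero`).  So the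
  `β ≥ 1` terms of (1.13) are one-sided derivatives (`derivWithin … (Set.Ici 0) 0` / `iteratedDerivWithin`), and the
  two readings differ already at `β = 1`.
* §5 (v1.1, append-only) THE ONE-SIDED READING TO ALL ORDERS (carrier level, bare mass fixed, `m₀² > 0`,
  `μ₀² > 0`): with `M_n(λ) = ∫(−V)ⁿexp(−S₀ − λV)` (`momentFn`; `M₀ = Z`, `momentFn_zero_eq`), `M_{n+1}` is the right
  derivative of `M_n` on `[0, ∞)` (`hasDerivWithinAt_momentFn`, dominated convergence with the bound `Vⁿ⁺¹e^{−S₀}`,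
  `integrable_quartic_pow_mul_exp`), hence **`λ ↦ Z(λ)` and `λ ↦ log Z(λ)` are `C^∞` on `Set.Ici 0`**
  (`contDiffOn_partitionFn_lam_Ici`, `contDiffOn_log_partitionFn_lam_Ici`) and
  **`iteratedDerivWithin β (λ ↦ Z(λ)) (Ici 0) 0 = ∫(−V)^β exp(−S₀)`** (`iteratedDerivWithin_partitionFn_lam_Ici`) — the
  perturbation-expansion coefficients; so every `iteratedDerivWithin β (…) (Set.Ici 0) 0` of a repaired (1.13) is a
  genuine derivative at the carrier level.
v1.2 (append-only): §6 `e1R_sub_e1` — for `N ≥ 1`, r01's repaired `ModelData.e1R` (p331274) minus `ModelData.e1`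
is exactly the `β ≥ 1` part of `e1R` (every `λ`-counterterm of (1.13)); `e1R_eq_e1_iff`; v1.0/v1.1 declarations
byte-identical.
HONEST SCOPE.  Nothing of the paper is contradicted: (1.13) is a perturbation expansion and the print never
differentiates `Z` at negative `λ`.  What is shown is that the decl of record `ModelData.e1` does not denote the
printed `E₁` when `N ≥ 1` (its `β ≥ 1` terms vanish identically), hence `ModelData.zRen` / `cutoffFamily` / `Thm114`
instantiate (1.14) with `E = E₀ + (the β = 0 part of E₁)`.  The repair (owner's call, row B1.Eq1.13: r01 / fold owner
r14) is to read the `λ`-derivatives one-sidedly (`iteratedDerivWithin β (λ' ↦ logZ P e' λ') (Set.Ici 0) 0`) — §4 proves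
the first of these exists and is non-zero at the carrier level with the mass held fixed; in `ModelData.zOf` the bare
mass `m² + δm²(ε, e', λ')` ALSO moves with `λ'`, and `ModelData` records no regularity of the data `δmsq`, which a
repaired decl must supply (e.g. the polynomial form of [Balaban1983Higgs3] (1.23)).  The `e'`-derivatives are not
affected (for `λ' > 0`, `Z` is finite for every real `e'`).
-/

namespace Literature.MathematicalPhysics.QuantumFieldTheory.Balaban1983to89.B1Eq113OneSidedDerivatives

open HiggsLattice HiggsActionIntegrable B1Sect1Statements MeasureTheory Set Filter Topology

-- the carrier names `Params`, `Site`, `PBond`, `VecField`, `ScalarField` are HiggsLattice's throughout (qualified: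
-- sibling modules declare homonyms in the enclosing namespace)
open scoped BigOperators

/-! ## §1  `λ < 0`: the integrand of (1.10) is not integrable; the Bochner value of `Z` is `0` -/

section NegativeCoupling

variable {P : HiggsLattice.Params} {k N : ℕ}

/-- At the zero scalar field the covariant kinetic form vanishes. [cite: Balaban1982Higgs1, (1.11) p.605] -/
theorem covLaplaceForm_zero_field (C : HiggsLattice.ChargeData N) (A : HiggsLattice.VecField P k) :
    covLaplaceForm C A (0 : HiggsLattice.ScalarField P k N) = 0 := by
  unfold covLaplaceForm covDeriv
  simp

/-- At the zero scalar field the self-interaction vanishes. [cite: Balaban1982Higgs1, (1.8) p.605] -/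
theorem potential_zero_field (c : HiggsLattice.Couplings) : potential (P := P) (k := k) c (0 : HiggsLattice.ScalarField P k N) = 0 := by
  unfold potential
  simp

/-- `S^ε(A, 0) = ½⟨A, (−Δ^ε + μ₀²)A⟩ + E` — the action (1.11) at `φ = 0` is the vector-field Gaussian plus the constant.
[cite: Balaban1982Higgs1, (1.11) p.605] -/
theorem action_zero_field (C : HiggsLattice.ChargeData N) (c : HiggsLattice.Couplings) (A : HiggsLattice.VecField P k) :
    action C c A (0 : HiggsLattice.ScalarField P k N)
      = (vecLaplaceForm A + ∑ b : HiggsLattice.PBond P k, P.mesh k ^ P.d * (c.mu0sq * (A b) ^ 2)) / 2 + c.E := by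
  unfold action
  rw [covLaplaceForm_zero_field, potential_zero_field]
  ring

/-- The lattice bound `⟨φ, (−Δ^η_A)φ⟩ ≤ 4dη⁻² Σ_x η^d|φ(x)|²` for the covariant kinetic form of (1.11) (every bond term
is `≤ 2η⁻²(|φ(b₊)|² + |φ(b₋)|²)` since `U(A_b)` is an isometry; each site is the initial point of `d` and the final point
of `d` positively oriented bonds). [cite: Balaban1982Higgs1, (1.11) p.605] -/
theorem covLaplaceForm_le (C : HiggsLattice.ChargeData N) (A : HiggsLattice.VecField P k) (φ : HiggsLattice.ScalarField P k N) :
    covLaplaceForm C A φ ≤ 4 * P.d * (P.mesh k)⁻¹ ^ 2 * ∑ x : HiggsLattice.Site P k, P.mesh k ^ P.d * ‖φ x‖ ^ 2 := by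
  have hmesh : 0 ≤ P.mesh k ^ P.d := pow_nonneg (P.mesh_pos k).le _
  have hterm : ∀ b : HiggsLattice.PBond P k, P.mesh k ^ P.d * ‖covDeriv C A φ b‖ ^ 2
      ≤ P.mesh k ^ P.d * (2 * (P.mesh k)⁻¹ ^ 2 * (‖φ b.tgt‖ ^ 2 + ‖φ b.src‖ ^ 2)) :=
    fun b => mul_le_mul_of_nonneg_left (B1Ineq233Upper.norm_covDeriv_sq_le C A φ b) hmesh
  calc covLaplaceForm C A φ
      ≤ ∑ b : HiggsLattice.PBond P k, P.mesh k ^ P.d * (2 * (P.mesh k)⁻¹ ^ 2 * (‖φ b.tgt‖ ^ 2 + ‖φ b.src‖ ^ 2)) :=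
        Finset.sum_le_sum fun b _ => hterm b
    _ = 2 * (P.mesh k)⁻¹ ^ 2 * (∑ b : HiggsLattice.PBond P k, P.mesh k ^ P.d * ‖φ b.tgt‖ ^ 2
          + ∑ b : HiggsLattice.PBond P k, P.mesh k ^ P.d * ‖φ b.src‖ ^ 2) := by
        rw [← Finset.sum_add_distrib, Finset.mul_sum]
        exact Finset.sum_congr rfl fun b _ => by ring
    _ = 4 * P.d * (P.mesh k)⁻¹ ^ 2 * ∑ x : HiggsLattice.Site P k, P.mesh k ^ P.d * ‖φ x‖ ^ 2 := by
        rw [B1Ineq233Upper.sum_bond_tgt_sq, B1Ineq233Upper.sum_bond_src_sq, HiggsCovariancePos.siteInner_self_eq]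
        ring

/-- For a NEGATIVE quartic coupling the one-site polynomial `λr⁴ + ar²` is bounded above:
`λr⁴ + ar² ≤ a²/(4(−λ))` (complete the square). [folklore] -/
private theorem quartic_upper (lam a : ℝ) (hlam : lam < 0) (r : ℝ) : lam * r ^ 4 + a * r ^ 2 ≤ a ^ 2 / (4 * (-lam)) := by
  have hμ : 0 < -lam := neg_pos.2 hlam
  have hne : lam ≠ 0 := hlam.ne
  have h : a ^ 2 / (4 * (-lam)) - (lam * r ^ 4 + a * r ^ 2) = ((-lam) * r ^ 2 - a / 2) ^ 2 / (-lam) := by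
    field_simp
    ring
  have h' : 0 ≤ ((-lam) * r ^ 2 - a / 2) ^ 2 / (-lam) := by positivity
  linarith

/-- The constant gained per site when `λ < 0`: `κ = η^d · a²/(4(−λ))` with `a = m₀²/2 + 2dη⁻²` (the coefficient of
`|φ(x)|²` after the covariant kinetic form is bounded by `covLaplaceForm_le`). [cite: Balaban1982Higgs1, (1.11) p.605] -/
noncomputable def siteGain (P : HiggsLattice.Params) (k : ℕ) (c : HiggsLattice.Couplings) : ℝ :=
  P.mesh k ^ P.d * ((c.m0sq / 2 + 2 * P.d * (P.mesh k)⁻¹ ^ 2) ^ 2 / (4 * (-c.lam)))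

/-- **`λ < 0`: the action is bounded above along every scalar fibre**,
`S^ε(A, φ) ≤ S^ε(A, 0) + |T^{(k)}|·κ` — the negative quartic term dominates the (bounded) covariant kinetic form and the
mass term sitewise. [cite: Balaban1982Higgs1, (1.11) p.605] -/
theorem action_le_action_zero_add (C : HiggsLattice.ChargeData N) (c : HiggsLattice.Couplings) (hlam : c.lam < 0) (A : HiggsLattice.VecField P k)
    (φ : HiggsLattice.ScalarField P k N) :
    action C c A φ ≤ action C c A 0 + Fintype.card (HiggsLattice.Site P k) * siteGain P k c := by
  have hmesh : 0 ≤ P.mesh k ^ P.d := pow_nonneg (P.mesh_pos k).le _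
  have hdiff : action C c A φ - action C c A 0 = covLaplaceForm C A φ / 2 + potential c φ := by
    rw [action_zero_field]
    unfold action
    ring
  have hcov := covLaplaceForm_le C A φ
  have hsite : ∀ x : HiggsLattice.Site P k,
      P.mesh k ^ P.d * (c.m0sq / 2 * ‖φ x‖ ^ 2 + c.lam * ‖φ x‖ ^ 4)
        + 2 * P.d * (P.mesh k)⁻¹ ^ 2 * (P.mesh k ^ P.d * ‖φ x‖ ^ 2) ≤ siteGain P k c := by
    intro x
    have hq := quartic_upper c.lam (c.m0sq / 2 + 2 * P.d * (P.mesh k)⁻¹ ^ 2) hlam ‖φ x‖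
    have h := mul_le_mul_of_nonneg_left hq hmesh
    unfold siteGain
    have e : P.mesh k ^ P.d * (c.m0sq / 2 * ‖φ x‖ ^ 2 + c.lam * ‖φ x‖ ^ 4)
        + 2 * P.d * (P.mesh k)⁻¹ ^ 2 * (P.mesh k ^ P.d * ‖φ x‖ ^ 2)
        = P.mesh k ^ P.d * (c.lam * ‖φ x‖ ^ 4 + (c.m0sq / 2 + 2 * P.d * (P.mesh k)⁻¹ ^ 2) * ‖φ x‖ ^ 2) := by
      ring
    rw [e]
    exact h
  have hsum : (∑ x : HiggsLattice.Site P k, P.mesh k ^ P.d * (c.m0sq / 2 * ‖φ x‖ ^ 2 + c.lam * ‖φ x‖ ^ 4))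
      + 2 * P.d * (P.mesh k)⁻¹ ^ 2 * ∑ x : HiggsLattice.Site P k, P.mesh k ^ P.d * ‖φ x‖ ^ 2
      ≤ Fintype.card (HiggsLattice.Site P k) * siteGain P k c := by
    rw [Finset.mul_sum, ← Finset.sum_add_distrib]
    calc ∑ x : HiggsLattice.Site P k, (P.mesh k ^ P.d * (c.m0sq / 2 * ‖φ x‖ ^ 2 + c.lam * ‖φ x‖ ^ 4)
          + 2 * P.d * (P.mesh k)⁻¹ ^ 2 * (P.mesh k ^ P.d * ‖φ x‖ ^ 2))
        ≤ ∑ _x : HiggsLattice.Site P k, siteGain P k c := Finset.sum_le_sum fun x _ => hsite x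
      _ = Fintype.card (HiggsLattice.Site P k) * siteGain P k c := by
        rw [Finset.sum_const, Finset.card_univ, nsmul_eq_mul]
  have hpot : potential c φ = ∑ x : HiggsLattice.Site P k, P.mesh k ^ P.d * (c.m0sq / 2 * ‖φ x‖ ^ 2 + c.lam * ‖φ x‖ ^ 4) := rfl
  have hcov' : covLaplaceForm C A φ / 2 ≤ 2 * P.d * (P.mesh k)⁻¹ ^ 2 * ∑ x : HiggsLattice.Site P k, P.mesh k ^ P.d * ‖φ x‖ ^ 2 := by
    linarith
  linarith

/-- The scalar-field fibre `T^{(k)} → ℝ^N` (`N ≥ 1`) has infinite Lebesgue measure. [folklore] -/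
private theorem volume_scalarField_univ (hN : 1 ≤ N) : (volume : Measure (HiggsLattice.ScalarField P k N)) univ = ⊤ := by
  haveI : Nonempty (Fin N) := ⟨⟨0, hN⟩⟩
  exact measure_univ_of_isAddLeftInvariant _

/-- **`λ < 0`, `N ≥ 1`: `exp(−S^ε)` is NOT integrable for `dA dφ`** (any real `m₀²`, `μ₀²`, `e`, `E`) — the converse
side of `HiggsActionIntegrable.integrable_exp_neg_action` (`λ > 0`).  Mechanism: by `action_le_action_zero_add`,
`exp(−S^ε(A, φ)) ≥ exp(−|T|κ)·exp(−S^ε(A, 0))`, a positive function of `A` alone; an integrable function on the product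
`(bonds → ℝ) × (sites → ℝ^N)` has integrable sections for a.e. `A`, but a positive constant is not integrable over the
infinite-measure fibre. [cite: Balaban1982Higgs1, (1.10) p.605] -/
theorem not_integrable_exp_neg_action (hN : 1 ≤ N) (C : HiggsLattice.ChargeData N) (c : HiggsLattice.Couplings) (hlam : c.lam < 0) :
    ¬ Integrable (fun Φ : HiggsLattice.VecField P k × HiggsLattice.ScalarField P k N => Real.exp (-action C c Φ.1 Φ.2)) := by
  intro h
  set B : ℝ := Fintype.card (HiggsLattice.Site P k) * siteGain P k c with hB
  have hcont : Continuous fun Φ : HiggsLattice.VecField P k × HiggsLattice.ScalarField P k N =>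
      Real.exp (-B) * Real.exp (-action C c Φ.1 (0 : HiggsLattice.ScalarField P k N)) := by
    have h1 : Continuous fun Φ : HiggsLattice.VecField P k × HiggsLattice.ScalarField P k N => (Φ.1, (0 : HiggsLattice.ScalarField P k N)) := by
      fun_prop
    exact continuous_const.mul (Real.continuous_exp.comp (((continuous_action C c).comp h1).neg))
  have hg : Integrable (fun Φ : HiggsLattice.VecField P k × HiggsLattice.ScalarField P k N =>
      Real.exp (-B) * Real.exp (-action C c Φ.1 (0 : HiggsLattice.ScalarField P k N))) := by
    refine h.mono' hcont.aestronglyMeasurable (Filter.Eventually.of_forall fun Φ => ?_)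
    rw [Real.norm_eq_abs, abs_of_pos (mul_pos (Real.exp_pos _) (Real.exp_pos _)), ← Real.exp_add,
      Real.exp_le_exp]
    have := action_le_action_zero_add C c hlam Φ.1 Φ.2
    linarith
  rw [Measure.volume_eq_prod] at hg
  have hae := ((integrable_prod_iff hg.aestronglyMeasurable).1 hg).1
  haveI : Nonempty (HiggsLattice.PBond P k) := ⟨⟨default, ⟨0, P.hd⟩⟩⟩
  have hV : (volume : Measure (HiggsLattice.VecField P k)) ≠ 0 := by
    intro h0
    have := measure_univ_of_isAddLeftInvariant (volume : Measure (HiggsLattice.VecField P k))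
    rw [h0] at this
    simp at this
  haveI : (ae (volume : Measure (HiggsLattice.VecField P k))).NeBot := ae_neBot.2 hV
  obtain ⟨A, hA⟩ := hae.exists
  have hc : Real.exp (-B) * Real.exp (-action C c A (0 : HiggsLattice.ScalarField P k N)) ≠ 0 :=
    (mul_pos (Real.exp_pos _) (Real.exp_pos _)).ne'
  have hfin : IsFiniteMeasure (volume : Measure (HiggsLattice.ScalarField P k N)) :=
    (integrable_const_iff_isFiniteMeasure hc).1 hA
  have hlt : (volume : Measure (HiggsLattice.ScalarField P k N)) univ < ⊤ := by
    haveI := hfin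
    exact measure_lt_top _ _
  rw [volume_scalarField_univ hN] at hlt
  exact lt_irrefl _ hlt

/-- **`λ < 0`, `N ≥ 1`: the Lebesgue (Bochner) value of the partition function (1.10) is `0`** (Lean's convention
for non-integrable integrands). [cite: Balaban1982Higgs1, (1.10) p.605] -/
theorem partitionFn_eq_zero_of_lam_neg (hN : 1 ≤ N) (C : HiggsLattice.ChargeData N) (c : HiggsLattice.Couplings) (hlam : c.lam < 0) :
    partitionFn P k N C c = 0 := by
  unfold partitionFn
  exact integral_undef (not_integrable_exp_neg_action hN C c hlam)

end NegativeCoupling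

/-! ## §2  Calculus: a function vanishing on `(−∞, 0)` has all two-sided (iterated) derivatives `0` at `0` -/

section Calculus

/-- If `g = 0` on `(−∞, 0)` then Lean's two-sided `deriv g 0 = 0`: either `g` is not differentiable at `0` (and
`deriv` is `0` by convention), or it is, and then `g(0) = 0` by continuity from the left and the derivative equals the
derivative of the zero function within `Iio 0` (a set of unique differentiability at `0`). [folklore] -/
private theorem deriv_eq_zero_of_eqOn_Iio {g : ℝ → ℝ} (hg : ∀ x < 0, g x = 0) : deriv g 0 = 0 := by
  by_cases hd : DifferentiableAt ℝ g 0
  · have hev : g =ᶠ[𝓝[Iio 0] 0] fun _ => (0 : ℝ) := by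
      filter_upwards [self_mem_nhdsWithin] with x hx using hg x hx
    have h0 : g 0 = 0 := by
      have h1 : Tendsto g (𝓝[Iio 0] 0) (𝓝 (g 0)) := hd.continuousAt.continuousWithinAt.tendsto
      have h2 : Tendsto g (𝓝[Iio 0] 0) (𝓝 0) := (tendsto_const_nhds (x := (0 : ℝ))).congr' hev.symm
      exact tendsto_nhds_unique h1 h2
    have hw : HasDerivWithinAt g (deriv g 0) (Iio 0) 0 := hd.hasDerivAt.hasDerivWithinAt
    have hw0 : HasDerivWithinAt g 0 (Iio 0) 0 :=
      (hasDerivWithinAt_const (0 : ℝ) (Iio 0) (0 : ℝ)).congr_of_eventuallyEq hev (by simp [h0])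
    exact (uniqueDiffWithinAt_Iio 0).eq_deriv _ hw hw0
  · exact deriv_zero_of_not_differentiableAt hd

/-- If `g = 0` on `(−∞, 0)` then `iteratedDeriv n g 0 = 0` for every `n ≥ 1` (the `(n−1)`-st iterated derivative again
vanishes on the open set `(−∞, 0)`). [folklore] -/
private theorem iteratedDeriv_eq_zero_of_eqOn_Iio {g : ℝ → ℝ} (hg : ∀ x < 0, g x = 0) {n : ℕ} (hn : 1 ≤ n) :
    iteratedDeriv n g 0 = 0 := by
  obtain ⟨m, rfl⟩ := Nat.exists_eq_add_of_le' hn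
  rw [iteratedDeriv_succ]
  apply deriv_eq_zero_of_eqOn_Iio
  intro x hx
  have hev : g =ᶠ[𝓝 x] fun _ => (0 : ℝ) := by
    filter_upwards [Iio_mem_nhds hx] with y hy using hg y hy
  rw [hev.iteratedDeriv_eq]
  simp

end Calculus

/-! ## §3  The finding: every `β ≥ 1` term of the typed `E₁` vanishes -/

section Finding

variable (D : ModelData) (P : HiggsLattice.Params)

/-- For `N ≥ 1` and `λ' < 0`, r01's `zOf P e' λ' E` — the partition function (1.10) at quartic coupling `λ'` — has
Lebesgue value `0`. [cite: Balaban1982Higgs1, (1.10) p.605] -/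
theorem zOf_eq_zero_of_neg (hN : 1 ≤ D.N) (e' E : ℝ) {lam' : ℝ} (hlam : lam' < 0) : D.zOf P e' lam' E = 0 :=
  partitionFn_eq_zero_of_lam_neg hN _ _ hlam

/-- For `N ≥ 1`, the function `λ' ↦ log Z(e', λ')` of (1.13), as typed (`ModelData.logZ`), VANISHES on `(−∞, 0)`
(`log 0 = 0`). [cite: Balaban1982Higgs1, (1.13) p.606] -/
theorem logZ_eq_zero_of_neg (hN : 1 ≤ D.N) (e' : ℝ) {lam' : ℝ} (hlam : lam' < 0) : D.logZ P e' lam' = 0 := by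
  unfold ModelData.logZ
  rw [zOf_eq_zero_of_neg D P hN e' 0 hlam, Real.log_zero]

/-- **THE FINDING (kernel form).** For `N ≥ 1`, every `e'` and every `β ≥ 1`:
`iteratedDeriv β (λ' ↦ logZ P e' λ') 0 = 0` — the two-sided iterated `λ'`-derivatives at `0` of the typed `log Z`
all vanish, for every choice of the data (`m², μ₀², δm², …`). [cite: Balaban1982Higgs1, (1.13) p.606] -/
theorem iteratedDeriv_logZ_lam_eq_zero (hN : 1 ≤ D.N) (e' : ℝ) {β : ℕ} (hβ : 1 ≤ β) :
    iteratedDeriv β (fun lam' => D.logZ P e' lam') 0 = 0 :=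
  iteratedDeriv_eq_zero_of_eqOn_Iio (fun _ hx => logZ_eq_zero_of_neg D P hN e' hx) hβ

/-- **Consequence for the decl of record of (1.13).** For `N ≥ 1`, `ModelData.e1 P` equals its `β = 0` sub-sum
`Σ_{1≤α≤n̄} (α!)⁻¹ e^α · (d/de')^α log Z(e', 0)|_{e'=0}`: no term of (1.13) with a `λ`-derivative (`β ≥ 1`) contributes
to the typed `E₁`. [cite: Balaban1982Higgs1, (1.13) p.606] -/
theorem e1_eq_sum_beta_zero (hN : 1 ≤ D.N) :
    D.e1 P = ∑ α ∈ Finset.range (D.nbar + 1),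
      if 1 ≤ α ∧ α ≤ D.nbar then
        1 / ((Nat.factorial α : ℝ) * (Nat.factorial 0 : ℝ)) * D.C.e ^ α * D.lam ^ 0 *
          iteratedDeriv α (fun e' => D.logZ P e' 0) 0
      else 0 := by
  unfold ModelData.e1
  refine Finset.sum_congr rfl fun α _ => ?_
  rw [Finset.sum_eq_single 0]
  · simp only [add_zero, iteratedDeriv_zero]
  · intro β _ hβ
    have hβ1 : 1 ≤ β := Nat.one_le_iff_ne_zero.2 hβ
    have hin : (fun e' => iteratedDeriv β (fun lam' => D.logZ P e' lam') 0) = fun _ => (0 : ℝ) := by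
      funext e'
      exact iteratedDeriv_logZ_lam_eq_zero D P hN e' hβ1
    rw [hin]
    split_ifs
    · simp
    · rfl
  · intro h
    simp at h

/-- The same statement with the trivial factors `0! = 1`, `λ^0 = 1` removed. [cite: Balaban1982Higgs1, (1.13) p.606] -/
theorem e1_eq_sum_beta_zero' (hN : 1 ≤ D.N) :
    D.e1 P = ∑ α ∈ Finset.range (D.nbar + 1),
      if 1 ≤ α ∧ α ≤ D.nbar then
        1 / (Nat.factorial α : ℝ) * D.C.e ^ α * iteratedDeriv α (fun e' => D.logZ P e' 0) 0
      else 0 := by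
  rw [e1_eq_sum_beta_zero D P hN]
  refine Finset.sum_congr rfl fun α _ => ?_
  split_ifs
  · simp
  · rfl

end Finding

/-! ## §4  What the print denotes: the RIGHT derivative at `λ = 0⁺` (carrier level, bare mass held fixed) -/

section RightDerivative

variable {P : HiggsLattice.Params} {k N : ℕ}

/-- The quartic site functional `V(φ) = Σ_x η^d |φ(x)|⁴` — the coefficient of `λ` in the action (1.11).
[cite: Balaban1982Higgs1, (1.11) p.605] -/
noncomputable def quartic (P : HiggsLattice.Params) (k : ℕ) (φ : HiggsLattice.ScalarField P k N) : ℝ :=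
  ∑ x : HiggsLattice.Site P k, P.mesh k ^ P.d * ‖φ x‖ ^ 4

/-- `V(φ) ≥ 0`. [cite: Balaban1982Higgs1, (1.11) p.605] -/
theorem quartic_nonneg (φ : HiggsLattice.ScalarField P k N) : 0 ≤ quartic P k φ :=
  Finset.sum_nonneg fun _ _ => mul_nonneg (pow_nonneg (P.mesh_pos k).le _) (pow_nonneg (norm_nonneg _) _)

/-- `V(φ) > 0` as soon as `φ ≠ 0`. [cite: Balaban1982Higgs1, (1.11) p.605] -/
theorem quartic_pos {φ : HiggsLattice.ScalarField P k N} (hφ : φ ≠ 0) : 0 < quartic P k φ := by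
  obtain ⟨x, hx⟩ : ∃ x, φ x ≠ 0 := by
    by_contra h
    push Not at h
    exact hφ (funext h)
  have hxpos : 0 < P.mesh k ^ P.d * ‖φ x‖ ^ 4 :=
    mul_pos (pow_pos (P.mesh_pos k) _) (pow_pos (norm_pos_iff.2 hx) _)
  exact lt_of_lt_of_le hxpos (Finset.single_le_sum (f := fun y => P.mesh k ^ P.d * ‖φ y‖ ^ 4)
    (fun y _ => mul_nonneg (pow_nonneg (P.mesh_pos k).le _) (pow_nonneg (norm_nonneg _) _)) (Finset.mem_univ x))

/-- `V` is continuous. [cite: Balaban1982Higgs1, (1.11) p.605] -/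
theorem continuous_quartic : Continuous fun φ : HiggsLattice.ScalarField P k N => quartic P k φ := by
  unfold quartic
  exact continuous_finsetSum _ fun x _ => (((continuous_apply x).norm).pow 4).const_mul _

/-- The action (1.11) is AFFINE in `λ`: `S^ε_{(m₀², λ, μ₀², E)} = S^ε_{(m₀², 0, μ₀², E)} + λ·V(φ)`.
[cite: Balaban1982Higgs1, (1.11) p.605] -/
theorem action_lam_split (C : HiggsLattice.ChargeData N) (m0sq lam mu0sq E : ℝ) (A : HiggsLattice.VecField P k)
    (φ : HiggsLattice.ScalarField P k N) :
    action C ⟨m0sq, lam, mu0sq, E⟩ A φ = action C ⟨m0sq, 0, mu0sq, E⟩ A φ + lam * quartic P k φ := by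
  have hpot : potential (P := P) (k := k) ⟨m0sq, lam, mu0sq, E⟩ φ
      = potential (P := P) (k := k) ⟨m0sq, 0, mu0sq, E⟩ φ + lam * quartic P k φ := by
    unfold potential quartic
    rw [Finset.mul_sum, ← Finset.sum_add_distrib]
    exact Finset.sum_congr rfl fun x _ => by ring
  unfold action
  rw [hpot]
  ring

/-- At `λ = 0` the action dominates the two mass terms: `S^ε ≥ E + ½Σ_b η^d μ₀²A_b² + Σ_x η^d ½m₀²|φ(x)|²`.
[cite: Balaban1982Higgs1, (1.11) p.605] -/
theorem action_lam_zero_ge (C : HiggsLattice.ChargeData N) (m0sq mu0sq E : ℝ) (A : HiggsLattice.VecField P k)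
    (φ : HiggsLattice.ScalarField P k N) :
    E + (∑ b : HiggsLattice.PBond P k, P.mesh k ^ P.d * (mu0sq * (A b) ^ 2)) / 2
        + ∑ x : HiggsLattice.Site P k, P.mesh k ^ P.d * (m0sq / 2 * ‖φ x‖ ^ 2)
      ≤ action C ⟨m0sq, 0, mu0sq, E⟩ A φ := by
  have hcov : 0 ≤ covLaplaceForm C A φ :=
    Finset.sum_nonneg fun b _ => mul_nonneg (pow_nonneg (P.mesh_pos k).le _) (sq_nonneg _)
  have hvec : 0 ≤ vecLaplaceForm A :=
    Finset.sum_nonneg fun μ _ => Finset.sum_nonneg fun b _ => mul_nonneg (pow_nonneg (P.mesh_pos k).le _) (sq_nonneg _)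
  have hpot : potential (P := P) (k := k) ⟨m0sq, 0, mu0sq, E⟩ φ
      = ∑ x : HiggsLattice.Site P k, P.mesh k ^ P.d * (m0sq / 2 * ‖φ x‖ ^ 2) := by
    unfold potential
    exact Finset.sum_congr rfl fun x _ => by ring
  unfold action
  rw [hpot]
  dsimp only
  linarith

/-- The Gaussian `exp(−b|v|²)`, `b > 0`, is integrable on `ℝ^N`. [folklore] -/
private theorem integrable_exp_neg_mul_sq_norm' {b : ℝ} (hb : 0 < b) :
    Integrable fun v : EuclideanSpace ℝ (Fin N) => Real.exp (-b * ‖v‖ ^ 2) := by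
  refine Integrable.of_integral_ne_zero ?_
  rw [GaussianFourier.integral_rexp_neg_mul_sq_norm hb]
  exact (Real.rpow_pos_of_pos (div_pos Real.pi_pos hb) _).ne'

/-- A product Gaussian `Π_b exp(−a A_b²) · Π_x exp(−b|φ(x)|²)`, `a, b > 0`, is integrable for `dA dφ`. [folklore] -/
private theorem integrable_gauss {a b : ℝ} (ha : 0 < a) (hb : 0 < b) :
    Integrable fun Φ : HiggsLattice.VecField P k × HiggsLattice.ScalarField P k N =>
      (∏ bd : HiggsLattice.PBond P k, Real.exp (-a * (Φ.1 bd) ^ 2))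
        * ∏ x : HiggsLattice.Site P k, Real.exp (-b * ‖Φ.2 x‖ ^ 2) := by
  have hA : Integrable fun A : HiggsLattice.VecField P k => ∏ bd : HiggsLattice.PBond P k, Real.exp (-a * (A bd) ^ 2) :=
    Integrable.fintype_prod (f := fun (_ : HiggsLattice.PBond P k) (t : ℝ) => Real.exp (-a * t ^ 2))
      fun _ => integrable_exp_neg_mul_sq ha
  have hφ : Integrable fun φ : HiggsLattice.ScalarField P k N => ∏ x : HiggsLattice.Site P k, Real.exp (-b * ‖φ x‖ ^ 2) :=
    Integrable.fintype_prod (f := fun (_ : HiggsLattice.Site P k) (v : EuclideanSpace ℝ (Fin N)) =>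
      Real.exp (-b * ‖v‖ ^ 2)) fun _ => integrable_exp_neg_mul_sq_norm' hb
  have h := hA.mul_prod hφ
  rw [← Measure.volume_eq_prod] at h
  exact h

/-- Polynomial ≤ exponential, sitewise: `V(φ) ≤ |T|·(2/(t²η^d))·exp(t Σ_x η^d|φ(x)|²)` for `t > 0`. [folklore] -/
private theorem quartic_le_exp {t : ℝ} (ht : 0 < t) (φ : HiggsLattice.ScalarField P k N) :
    quartic P k φ ≤ Fintype.card (HiggsLattice.Site P k) * (2 / (t ^ 2 * P.mesh k ^ P.d))
      * Real.exp (t * ∑ x : HiggsLattice.Site P k, P.mesh k ^ P.d * ‖φ x‖ ^ 2) := by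
  have hη : 0 < P.mesh k ^ P.d := pow_pos (P.mesh_pos k) _
  set S : ℝ := ∑ x : HiggsLattice.Site P k, P.mesh k ^ P.d * ‖φ x‖ ^ 2 with hS
  have hsite : ∀ x : HiggsLattice.Site P k,
      P.mesh k ^ P.d * ‖φ x‖ ^ 4 ≤ 2 / (t ^ 2 * P.mesh k ^ P.d) * Real.exp (t * S) := by
    intro x
    set s : ℝ := P.mesh k ^ P.d * ‖φ x‖ ^ 2 with hs
    have hs0 : 0 ≤ s := mul_nonneg hη.le (sq_nonneg _)
    have hsS : s ≤ S := Finset.single_le_sum (f := fun y => P.mesh k ^ P.d * ‖φ y‖ ^ 2)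
      (fun y _ => mul_nonneg hη.le (sq_nonneg _)) (Finset.mem_univ x)
    have h1 : (t * s) ^ 2 / 2 ≤ Real.exp (t * s) := by
      have := Real.pow_div_factorial_le_exp (t * s) (by positivity) 2
      simpa [Nat.factorial] using this
    have h2 : Real.exp (t * s) ≤ Real.exp (t * S) := Real.exp_le_exp.2 (by nlinarith)
    have h3 : P.mesh k ^ P.d * ‖φ x‖ ^ 4 = s ^ 2 / P.mesh k ^ P.d := by
      rw [hs, eq_div_iff hη.ne']; ring
    rw [h3, div_le_iff₀ hη]
    have h4 : s ^ 2 ≤ 2 / t ^ 2 * Real.exp (t * s) := by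
      rw [div_mul_eq_mul_div, le_div_iff₀ (by positivity)]
      nlinarith
    calc s ^ 2 ≤ 2 / t ^ 2 * Real.exp (t * s) := h4
      _ ≤ 2 / t ^ 2 * Real.exp (t * S) := mul_le_mul_of_nonneg_left h2 (by positivity)
      _ = 2 / (t ^ 2 * P.mesh k ^ P.d) * Real.exp (t * S) * P.mesh k ^ P.d := by
        field_simp
  calc quartic P k φ = ∑ x : HiggsLattice.Site P k, P.mesh k ^ P.d * ‖φ x‖ ^ 4 := rfl
    _ ≤ ∑ _x : HiggsLattice.Site P k, 2 / (t ^ 2 * P.mesh k ^ P.d) * Real.exp (t * S) :=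
        Finset.sum_le_sum fun x _ => hsite x
    _ = Fintype.card (HiggsLattice.Site P k) * (2 / (t ^ 2 * P.mesh k ^ P.d)) * Real.exp (t * S) := by
        rw [Finset.sum_const, Finset.card_univ, nsmul_eq_mul]; ring

/-- For `m₀² > 0`, `μ₀² > 0` and `λ = 0` (the free-in-`λ` action: Gaussian mass terms plus the non-negative kinetic
forms) `exp(−S^ε)` is integrable. [cite: Balaban1982Higgs1, (1.10) p.605] -/
theorem integrable_exp_neg_action_lam_zero {m0sq mu0sq : ℝ} (hm : 0 < m0sq) (hmu : 0 < mu0sq)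
    (C : HiggsLattice.ChargeData N) (E : ℝ) :
    Integrable fun Φ : HiggsLattice.VecField P k × HiggsLattice.ScalarField P k N =>
      Real.exp (-action C ⟨m0sq, 0, mu0sq, E⟩ Φ.1 Φ.2) := by
  have hη : 0 < P.mesh k ^ P.d := pow_pos (P.mesh_pos k) _
  have hmaj := (integrable_gauss (P := P) (k := k) (N := N) (a := P.mesh k ^ P.d * mu0sq / 2)
    (b := P.mesh k ^ P.d * (m0sq / 2)) (by positivity) (by positivity)).const_mul (Real.exp (-E))
  refine hmaj.mono' (measurable_exp_neg_action C _).aestronglyMeasurable (Filter.Eventually.of_forall fun Φ => ?_)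
  rw [Real.norm_eq_abs, abs_of_pos (Real.exp_pos _), ← Real.exp_sum, ← Real.exp_sum, ← Real.exp_add,
    ← Real.exp_add, Real.exp_le_exp]
  have h := action_lam_zero_ge C m0sq mu0sq E Φ.1 Φ.2
  have e1 : ∑ bd : HiggsLattice.PBond P k, -(P.mesh k ^ P.d * mu0sq / 2) * (Φ.1 bd) ^ 2
      = -((∑ bd : HiggsLattice.PBond P k, P.mesh k ^ P.d * (mu0sq * (Φ.1 bd) ^ 2)) / 2) := by
    rw [Finset.sum_div, ← Finset.sum_neg_distrib]
    exact Finset.sum_congr rfl fun b _ => by ring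
  have e2 : ∑ x : HiggsLattice.Site P k, -(P.mesh k ^ P.d * (m0sq / 2)) * ‖Φ.2 x‖ ^ 2
      = -∑ x : HiggsLattice.Site P k, P.mesh k ^ P.d * (m0sq / 2 * ‖Φ.2 x‖ ^ 2) := by
    rw [← Finset.sum_neg_distrib]
    exact Finset.sum_congr rfl fun x _ => by ring
  rw [e1, e2]
  linarith

/-- For `m₀² > 0`, `μ₀² > 0`: the quartic moment density `V(φ)·exp(−S^ε_{λ=0})` is integrable (polynomial times
Gaussian). [cite: Balaban1982Higgs1, (1.10) p.605] -/
theorem integrable_quartic_mul_exp {m0sq mu0sq : ℝ} (hm : 0 < m0sq) (hmu : 0 < mu0sq)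
    (C : HiggsLattice.ChargeData N) (E : ℝ) :
    Integrable fun Φ : HiggsLattice.VecField P k × HiggsLattice.ScalarField P k N =>
      quartic P k Φ.2 * Real.exp (-action C ⟨m0sq, 0, mu0sq, E⟩ Φ.1 Φ.2) := by
  have hη : 0 < P.mesh k ^ P.d := pow_pos (P.mesh_pos k) _
  set Kq : ℝ := Fintype.card (HiggsLattice.Site P k) * (2 / ((m0sq / 4) ^ 2 * P.mesh k ^ P.d)) with hKq
  have hKq0 : 0 ≤ Kq := by positivity
  have hmaj := (integrable_gauss (P := P) (k := k) (N := N) (a := P.mesh k ^ P.d * mu0sq / 2)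
    (b := P.mesh k ^ P.d * (m0sq / 4)) (by positivity) (by positivity)).const_mul (Kq * Real.exp (-E))
  have hcont : Continuous fun Φ : HiggsLattice.VecField P k × HiggsLattice.ScalarField P k N =>
      quartic P k Φ.2 * Real.exp (-action C ⟨m0sq, 0, mu0sq, E⟩ Φ.1 Φ.2) :=
    (continuous_quartic.comp continuous_snd).mul (Real.continuous_exp.comp (continuous_action C _).neg)
  refine hmaj.mono' hcont.aestronglyMeasurable (Filter.Eventually.of_forall fun Φ => ?_)
  rw [Real.norm_eq_abs, abs_of_nonneg (mul_nonneg (quartic_nonneg _) (Real.exp_pos _).le)]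
  have hV := quartic_le_exp (P := P) (k := k) (t := m0sq / 4) (by positivity) Φ.2
  have hS := action_lam_zero_ge C m0sq mu0sq E Φ.1 Φ.2
  -- the Gaussian majorant, written as one exponential
  have hexp : (∏ bd : HiggsLattice.PBond P k, Real.exp (-(P.mesh k ^ P.d * mu0sq / 2) * (Φ.1 bd) ^ 2))
      * ∏ x : HiggsLattice.Site P k, Real.exp (-(P.mesh k ^ P.d * (m0sq / 4)) * ‖Φ.2 x‖ ^ 2)
      = Real.exp (-((∑ bd : HiggsLattice.PBond P k, P.mesh k ^ P.d * (mu0sq * (Φ.1 bd) ^ 2)) / 2)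
          - (m0sq / 4) * ∑ x : HiggsLattice.Site P k, P.mesh k ^ P.d * ‖Φ.2 x‖ ^ 2) := by
    rw [← Real.exp_sum, ← Real.exp_sum, ← Real.exp_add]
    congr 1
    rw [Finset.sum_div, Finset.mul_sum, sub_eq_add_neg, ← Finset.sum_neg_distrib, ← Finset.sum_neg_distrib]
    congr 1
    · exact Finset.sum_congr rfl fun b _ => by ring
    · exact Finset.sum_congr rfl fun x _ => by ring
  rw [hexp]
  have hm2 : ∑ x : HiggsLattice.Site P k, P.mesh k ^ P.d * (m0sq / 2 * ‖Φ.2 x‖ ^ 2)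
      = (m0sq / 2) * ∑ x : HiggsLattice.Site P k, P.mesh k ^ P.d * ‖Φ.2 x‖ ^ 2 := by
    rw [Finset.mul_sum]; exact Finset.sum_congr rfl fun x _ => by ring
  set G : ℝ := (∑ bd : HiggsLattice.PBond P k, P.mesh k ^ P.d * (mu0sq * (Φ.1 bd) ^ 2)) / 2
  set Q : ℝ := ∑ x : HiggsLattice.Site P k, P.mesh k ^ P.d * ‖Φ.2 x‖ ^ 2
  have hact : Real.exp (-action C ⟨m0sq, 0, mu0sq, E⟩ Φ.1 Φ.2) ≤ Real.exp (-(E + G + m0sq / 2 * Q)) := by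
    rw [Real.exp_le_exp]; rw [hm2] at hS; linarith
  have hee : Real.exp (m0sq / 4 * Q) * Real.exp (-(E + G + m0sq / 2 * Q))
      = Real.exp (-E) * Real.exp (-G - m0sq / 4 * Q) := by
    rw [← Real.exp_add, ← Real.exp_add]; congr 1; ring
  calc quartic P k Φ.2 * Real.exp (-action C ⟨m0sq, 0, mu0sq, E⟩ Φ.1 Φ.2)
      ≤ (Kq * Real.exp (m0sq / 4 * Q)) * Real.exp (-(E + G + m0sq / 2 * Q)) :=
        mul_le_mul hV hact (Real.exp_pos _).le (by positivity)
    _ = Kq * (Real.exp (m0sq / 4 * Q) * Real.exp (-(E + G + m0sq / 2 * Q))) := by ring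
    _ = Kq * (Real.exp (-E) * Real.exp (-G - m0sq / 4 * Q)) := by rw [hee]
    _ = Kq * Real.exp (-E) * Real.exp (-G - m0sq / 4 * Q) := by ring

/-- `Z(λ = 0) > 0` for `m₀² > 0`, `μ₀² > 0`. [cite: Balaban1982Higgs1, (1.10) p.605] -/
theorem partitionFn_lam_zero_pos {m0sq mu0sq : ℝ} (hm : 0 < m0sq) (hmu : 0 < mu0sq)
    (C : HiggsLattice.ChargeData N) (E : ℝ) : 0 < partitionFn P k N C ⟨m0sq, 0, mu0sq, E⟩ := by
  haveI : (volume : Measure (HiggsLattice.VecField P k × HiggsLattice.ScalarField P k N)).IsAddHaarMeasure :=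
    Measure.prod.instIsAddHaarMeasure volume volume
  unfold partitionFn
  exact integral_exp_pos (integrable_exp_neg_action_lam_zero hm hmu C E)

/-- The quartic moment `∫ V(φ) exp(−S^ε_{λ=0}) dA dφ` is STRICTLY POSITIVE for `N ≥ 1` (its integrand is continuous,
non-negative, and positive on the non-empty open set `{φ ≠ 0}`). [cite: Balaban1982Higgs1, (1.10) p.605] -/
theorem integral_quartic_mul_exp_pos (hN : 1 ≤ N) {m0sq mu0sq : ℝ} (hm : 0 < m0sq) (hmu : 0 < mu0sq)
    (C : HiggsLattice.ChargeData N) (E : ℝ) :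
    0 < ∫ Φ : HiggsLattice.VecField P k × HiggsLattice.ScalarField P k N,
      quartic P k Φ.2 * Real.exp (-action C ⟨m0sq, 0, mu0sq, E⟩ Φ.1 Φ.2) := by
  haveI : (volume : Measure (HiggsLattice.VecField P k × HiggsLattice.ScalarField P k N)).IsOpenPosMeasure :=
    Measure.prod.instIsOpenPosMeasure
  rw [integral_pos_iff_support_of_nonneg (fun Φ => mul_nonneg (quartic_nonneg _) (Real.exp_pos _).le)
    (integrable_quartic_mul_exp hm hmu C E)]
  set U : Set (HiggsLattice.VecField P k × HiggsLattice.ScalarField P k N) := {Φ | Φ.2 ≠ 0} with hU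
  have hUopen : IsOpen U := isOpen_ne_fun continuous_snd continuous_const
  haveI : Nonempty (Fin N) := ⟨⟨0, hN⟩⟩
  have hUne : U.Nonempty := by
    obtain ⟨v, hv⟩ := exists_ne (0 : EuclideanSpace ℝ (Fin N))
    refine ⟨((0 : HiggsLattice.VecField P k), fun _ => v), ?_⟩
    simp only [hU, Set.mem_setOf_eq, ne_eq]
    intro h
    exact hv (by simpa using congr_fun h default)
  have hsub : U ⊆ Function.support (fun Φ : HiggsLattice.VecField P k × HiggsLattice.ScalarField P k N =>
      quartic P k Φ.2 * Real.exp (-action C ⟨m0sq, 0, mu0sq, E⟩ Φ.1 Φ.2)) := by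
    intro Φ hΦ
    exact (mul_pos (quartic_pos hΦ) (Real.exp_pos _)).ne'
  exact lt_of_lt_of_le (hUopen.measure_pos volume hUne) (measure_mono hsub)

/-- `|e^{−x} − 1| ≤ x` for `x ≥ 0`. [folklore] -/
private theorem abs_exp_neg_sub_one_le {x : ℝ} (hx : 0 ≤ x) : |Real.exp (-x) - 1| ≤ x := by
  have h1 : Real.exp (-x) ≤ 1 := by rw [Real.exp_le_one_iff]; linarith
  have h2 : 1 - x ≤ Real.exp (-x) := by have := Real.add_one_le_exp (-x); linarith
  rw [abs_sub_comm, abs_of_nonneg (by linarith)]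
  linarith

/-- **THE PRINTED OBJECT EXISTS (β = 1, carrier level): `λ ↦ Z(λ)` has a RIGHT derivative at `λ = 0`, equal to
minus the quartic moment**, `d⁺/dλ Z|_{λ=0} = −∫ V(φ) exp(−S^ε_{λ=0}) dA dφ` (`m₀² > 0`, `μ₀² > 0`; dominated
convergence with the bound `|λ⁻¹(e^{−λV} − 1)| ≤ V`). [cite: Balaban1982Higgs1, (1.13) p.606] -/
theorem hasDerivWithinAt_partitionFn_lam_Ici {m0sq mu0sq : ℝ} (hm : 0 < m0sq) (hmu : 0 < mu0sq)
    (C : HiggsLattice.ChargeData N) (E : ℝ) :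
    HasDerivWithinAt (fun lam => partitionFn P k N C ⟨m0sq, lam, mu0sq, E⟩)
      (-(∫ Φ : HiggsLattice.VecField P k × HiggsLattice.ScalarField P k N,
          quartic P k Φ.2 * Real.exp (-action C ⟨m0sq, 0, mu0sq, E⟩ Φ.1 Φ.2))) (Ici 0) 0 := by
  rw [← hasDerivWithinAt_Ioi_iff_Ici, hasDerivWithinAt_iff_tendsto_slope' (show (0 : ℝ) ∉ Ioi 0 by simp)]
  set S₀ : HiggsLattice.VecField P k × HiggsLattice.ScalarField P k N → ℝ :=
    fun Φ => action C ⟨m0sq, 0, mu0sq, E⟩ Φ.1 Φ.2 with hS₀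
  set F : ℝ → HiggsLattice.VecField P k × HiggsLattice.ScalarField P k N → ℝ :=
    fun lam Φ => lam⁻¹ * (Real.exp (-(S₀ Φ + lam * quartic P k Φ.2)) - Real.exp (-S₀ Φ)) with hF
  -- the slope of Z at 0 is the integral of F lam for lam > 0
  have hZ : ∀ lam : ℝ, partitionFn P k N C ⟨m0sq, lam, mu0sq, E⟩
      = ∫ Φ : HiggsLattice.VecField P k × HiggsLattice.ScalarField P k N, Real.exp (-(S₀ Φ + lam * quartic P k Φ.2)) := by
    intro lam
    unfold partitionFn
    refine integral_congr_ae (Filter.Eventually.of_forall fun Φ => ?_)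
    simp only [hS₀]
    rw [action_lam_split]
  have hint : ∀ lam : ℝ, 0 < lam → Integrable (fun Φ : HiggsLattice.VecField P k × HiggsLattice.ScalarField P k N =>
      Real.exp (-(S₀ Φ + lam * quartic P k Φ.2))) := by
    intro lam hlam
    have h := HiggsActionIntegrable.integrable_exp_neg_action (P := P) (k := k) C ⟨m0sq, lam, mu0sq, E⟩ hmu hlam
    refine h.congr (Filter.Eventually.of_forall fun Φ => ?_)
    simp only [hS₀]
    rw [action_lam_split]
  have hint0 : Integrable (fun Φ : HiggsLattice.VecField P k × HiggsLattice.ScalarField P k N => Real.exp (-S₀ Φ)) :=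
    integrable_exp_neg_action_lam_zero hm hmu C E
  have key : ∀ lam : ℝ, 0 < lam →
      slope (fun lam => partitionFn P k N C ⟨m0sq, lam, mu0sq, E⟩) 0 lam
        = ∫ Φ : HiggsLattice.VecField P k × HiggsLattice.ScalarField P k N, F lam Φ := by
    intro lam hlam
    rw [slope_def_field, sub_zero, hZ lam, hZ 0]
    simp only [zero_mul, add_zero]
    rw [← integral_sub (hint lam hlam) hint0, div_eq_inv_mul, ← integral_const_mul]
  have hev : ∀ᶠ lam in 𝓝[Ioi (0 : ℝ)] 0, 0 < lam := self_mem_nhdsWithin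
  -- the four hypotheses of dominated convergence along `𝓝[>] 0`
  have hmeas : ∀ᶠ lam in 𝓝[Ioi (0 : ℝ)] 0, AEStronglyMeasurable (F lam)
      (volume : Measure (HiggsLattice.VecField P k × HiggsLattice.ScalarField P k N)) := by
    refine Filter.Eventually.of_forall fun lam => Continuous.aestronglyMeasurable ?_
    have hc0 : Continuous S₀ := continuous_action C _
    have hcq : Continuous fun Φ : HiggsLattice.VecField P k × HiggsLattice.ScalarField P k N => quartic P k Φ.2 :=
      continuous_quartic.comp continuous_snd
    exact continuous_const.mul ((Real.continuous_exp.comp (hc0.add (continuous_const.mul hcq)).neg).sub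
      (Real.continuous_exp.comp hc0.neg))
  have hbound : ∀ᶠ lam in 𝓝[Ioi (0 : ℝ)] 0, ∀ᵐ Φ : HiggsLattice.VecField P k × HiggsLattice.ScalarField P k N,
      ‖F lam Φ‖ ≤ quartic P k Φ.2 * Real.exp (-S₀ Φ) := by
    filter_upwards [hev] with lam hlam
    refine Filter.Eventually.of_forall fun Φ => ?_
    have hV := quartic_nonneg (P := P) (k := k) Φ.2
    have hx : 0 ≤ lam * quartic P k Φ.2 := mul_nonneg hlam.le hV
    have hfac : Real.exp (-(S₀ Φ + lam * quartic P k Φ.2)) - Real.exp (-S₀ Φ)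
        = Real.exp (-S₀ Φ) * (Real.exp (-(lam * quartic P k Φ.2)) - 1) := by
      rw [mul_sub, mul_one, ← Real.exp_add]; congr 1; ring
    simp only [hF]
    rw [hfac, Real.norm_eq_abs, abs_mul, abs_mul, abs_of_pos (inv_pos.2 hlam), abs_of_pos (Real.exp_pos _)]
    have hb := abs_exp_neg_sub_one_le hx
    calc lam⁻¹ * (Real.exp (-S₀ Φ) * |Real.exp (-(lam * quartic P k Φ.2)) - 1|)
        ≤ lam⁻¹ * (Real.exp (-S₀ Φ) * (lam * quartic P k Φ.2)) :=
          mul_le_mul_of_nonneg_left (mul_le_mul_of_nonneg_left hb (Real.exp_pos _).le) (inv_pos.2 hlam).le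
      _ = quartic P k Φ.2 * Real.exp (-S₀ Φ) := by field_simp
  have hlimpt : ∀ᵐ Φ : HiggsLattice.VecField P k × HiggsLattice.ScalarField P k N,
      Tendsto (fun lam => F lam Φ) (𝓝[Ioi (0 : ℝ)] 0) (𝓝 (-(quartic P k Φ.2 * Real.exp (-S₀ Φ)))) := by
    refine Filter.Eventually.of_forall fun Φ => ?_
    have hd : HasDerivAt (fun lam : ℝ => Real.exp (-(S₀ Φ + lam * quartic P k Φ.2)))
        (-(quartic P k Φ.2 * Real.exp (-S₀ Φ))) 0 := by
      have h1 : HasDerivAt (fun lam : ℝ => -(S₀ Φ + lam * quartic P k Φ.2)) (-(1 * quartic P k Φ.2)) 0 :=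
        (((hasDerivAt_id (0 : ℝ)).mul_const (quartic P k Φ.2)).const_add (S₀ Φ)).neg
      have h2 := h1.exp
      refine h2.congr_deriv ?_
      simp only [zero_mul, add_zero, one_mul]
      ring
    have ht := hd.tendsto_slope
    have hmono : 𝓝[Ioi (0 : ℝ)] 0 ≤ 𝓝[≠] 0 := nhdsWithin_mono _ fun x hx => ne_of_gt hx
    refine (ht.mono_left hmono).congr' ?_
    filter_upwards [hev] with lam hlam
    rw [slope_def_field]
    simp only [hF, sub_zero, zero_mul, add_zero, div_eq_inv_mul]
  have hT := tendsto_integral_filter_of_dominated_convergence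
    (fun Φ : HiggsLattice.VecField P k × HiggsLattice.ScalarField P k N => quartic P k Φ.2 * Real.exp (-S₀ Φ))
    hmeas hbound (integrable_quartic_mul_exp hm hmu C E) hlimpt
  have hlim_eq : (-(∫ Φ : HiggsLattice.VecField P k × HiggsLattice.ScalarField P k N,
        quartic P k Φ.2 * Real.exp (-action C ⟨m0sq, 0, mu0sq, E⟩ Φ.1 Φ.2)))
      = ∫ Φ : HiggsLattice.VecField P k × HiggsLattice.ScalarField P k N,
          -(quartic P k Φ.2 * Real.exp (-S₀ Φ)) := by
    rw [integral_neg]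
  rw [hlim_eq]
  refine hT.congr' ?_
  filter_upwards [hev] with lam hlam using (key lam hlam).symm

/-- Its two-sided `deriv` at `0`, by contrast, is `0` (`N ≥ 1`; `Z` vanishes on `λ < 0`).
[cite: Balaban1982Higgs1, (1.13) p.606] -/
theorem deriv_partitionFn_lam_eq_zero (hN : 1 ≤ N) (C : HiggsLattice.ChargeData N) (m0sq mu0sq E : ℝ) :
    deriv (fun lam => partitionFn P k N C ⟨m0sq, lam, mu0sq, E⟩) 0 = 0 :=
  deriv_eq_zero_of_eqOn_Iio fun lam hlam => partitionFn_eq_zero_of_lam_neg hN C ⟨m0sq, lam, mu0sq, E⟩ hlam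

/-- **The printed first `λ`-derivative of `log Z` at `λ = 0` (β = 1 in (1.13)), carrier level, bare mass fixed:
the RIGHT derivative exists and equals `−⟨V⟩₀ = −(∫ V e^{−S₀}) / (∫ e^{−S₀})`.** [cite: Balaban1982Higgs1, (1.13) p.606] -/
theorem hasDerivWithinAt_log_partitionFn_lam_Ici {m0sq mu0sq : ℝ} (hm : 0 < m0sq) (hmu : 0 < mu0sq)
    (C : HiggsLattice.ChargeData N) (E : ℝ) :
    HasDerivWithinAt (fun lam => Real.log (partitionFn P k N C ⟨m0sq, lam, mu0sq, E⟩))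
      (-(∫ Φ : HiggsLattice.VecField P k × HiggsLattice.ScalarField P k N,
          quartic P k Φ.2 * Real.exp (-action C ⟨m0sq, 0, mu0sq, E⟩ Φ.1 Φ.2))
        / partitionFn P k N C ⟨m0sq, 0, mu0sq, E⟩) (Ici 0) 0 :=
  (hasDerivWithinAt_partitionFn_lam_Ici hm hmu C E).log (partitionFn_lam_zero_pos hm hmu C E).ne'

/-- … and it is STRICTLY NEGATIVE for `N ≥ 1`: `derivWithin (λ ↦ log Z(λ)) (Ici 0) 0 < 0`.
[cite: Balaban1982Higgs1, (1.13) p.606] -/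
theorem derivWithin_log_partitionFn_lam_Ici_neg (hN : 1 ≤ N) {m0sq mu0sq : ℝ} (hm : 0 < m0sq) (hmu : 0 < mu0sq)
    (C : HiggsLattice.ChargeData N) (E : ℝ) :
    derivWithin (fun lam => Real.log (partitionFn P k N C ⟨m0sq, lam, mu0sq, E⟩)) (Ici 0) 0 < 0 := by
  rw [(hasDerivWithinAt_log_partitionFn_lam_Ici hm hmu C E).derivWithin (uniqueDiffWithinAt_Ici 0)]
  exact div_neg_of_neg_of_pos (neg_neg_of_pos (integral_quartic_mul_exp_pos hN hm hmu C E))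
    (partitionFn_lam_zero_pos hm hmu C E)

/-- … whereas the two-sided `deriv (λ ↦ log Z(λ)) 0 = 0` (`log Z` vanishes on `λ < 0` together with `Z`): the typed
reading `iteratedDeriv 1 (…) 0` and the printed one `derivWithin (…) (Ici 0) 0` DIFFER already at `β = 1`.
[cite: Balaban1982Higgs1, (1.13) p.606] -/
theorem deriv_log_partitionFn_lam_eq_zero (hN : 1 ≤ N) (C : HiggsLattice.ChargeData N) (m0sq mu0sq E : ℝ) :
    deriv (fun lam => Real.log (partitionFn P k N C ⟨m0sq, lam, mu0sq, E⟩)) 0 = 0 :=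
  deriv_eq_zero_of_eqOn_Iio fun lam hlam => by
    rw [partitionFn_eq_zero_of_lam_neg hN C ⟨m0sq, lam, mu0sq, E⟩ hlam, Real.log_zero]

end RightDerivative

/-! ## §5 (v1.1)  The one-sided reading to ALL orders: `λ ↦ Z(λ)` and `λ ↦ log Z(λ)` are `C^∞` on `[0, ∞)`, and the
right-sided iterated derivatives at `0` are the signed quartic moments (carrier level, bare mass fixed) -/

section AllOrders

open scoped ContDiff

variable {P : HiggsLattice.Params} {k N : ℕ}

/-- The signed quartic-moment functions `M_n(λ) = ∫ (−V(φ))ⁿ exp(−S^ε_{(m₀²,0,μ₀²,E)}(A,φ) − λV(φ)) dA dφ`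
(`M₀ = Z`, and `M_{n+1}` will be the right derivative of `M_n` on `[0, ∞)`). [cite: Balaban1982Higgs1, (1.13) p.606] -/
noncomputable def momentFn (P : HiggsLattice.Params) (k N : ℕ) (C : HiggsLattice.ChargeData N) (m0sq mu0sq E : ℝ)
    (n : ℕ) (lam : ℝ) : ℝ :=
  ∫ Φ : HiggsLattice.VecField P k × HiggsLattice.ScalarField P k N,
    (-quartic P k Φ.2) ^ n * Real.exp (-(action C ⟨m0sq, 0, mu0sq, E⟩ Φ.1 Φ.2 + lam * quartic P k Φ.2))

/-- `M₀(λ) = Z(λ)` for every real `λ` (the action is affine in `λ`). [cite: Balaban1982Higgs1, (1.10)–(1.11) p.605] -/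
theorem momentFn_zero_eq (C : HiggsLattice.ChargeData N) (m0sq mu0sq E lam : ℝ) :
    momentFn P k N C m0sq mu0sq E 0 lam = partitionFn P k N C ⟨m0sq, lam, mu0sq, E⟩ := by
  unfold momentFn partitionFn
  refine integral_congr_ae (Filter.Eventually.of_forall fun Φ => ?_)
  simp only [pow_zero, one_mul]
  rw [action_lam_split C m0sq lam mu0sq E]

/-- Powers of the quartic functional are still exponentially dominated: `V(φ)ⁿ ≤ K·exp(t Σ_x η^d|φ(x)|²)` for `t > 0`
(apply `quartic_le_exp` with `t/(n+1)`). [folklore] -/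
private theorem quartic_pow_le_exp {t : ℝ} (ht : 0 < t) (n : ℕ) (φ : HiggsLattice.ScalarField P k N) :
    quartic P k φ ^ n ≤ (Fintype.card (HiggsLattice.Site P k) * (2 / ((t / (n + 1)) ^ 2 * P.mesh k ^ P.d))) ^ n
      * Real.exp (t * ∑ x : HiggsLattice.Site P k, P.mesh k ^ P.d * ‖φ x‖ ^ 2) := by
  have hη : 0 < P.mesh k ^ P.d := pow_pos (P.mesh_pos k) _
  set S : ℝ := ∑ x : HiggsLattice.Site P k, P.mesh k ^ P.d * ‖φ x‖ ^ 2 with hS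
  have hS0 : 0 ≤ S := Finset.sum_nonneg fun x _ => mul_nonneg hη.le (sq_nonneg _)
  have hs : 0 < t / (n + 1) := by positivity
  have hV := quartic_le_exp (P := P) (k := k) hs φ
  set K : ℝ := Fintype.card (HiggsLattice.Site P k) * (2 / ((t / (n + 1)) ^ 2 * P.mesh k ^ P.d)) with hK
  have hK0 : 0 ≤ K := by positivity
  have h1 : quartic P k φ ^ n ≤ (K * Real.exp (t / (n + 1) * S)) ^ n :=
    pow_le_pow_left₀ (quartic_nonneg φ) hV n
  have h2 : (K * Real.exp (t / (n + 1) * S)) ^ n = K ^ n * Real.exp (n * (t / (n + 1)) * S) := by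
    rw [mul_pow, ← Real.exp_nat_mul]; ring_nf
  have h3 : Real.exp (n * (t / (n + 1)) * S) ≤ Real.exp (t * S) := by
    rw [Real.exp_le_exp]
    have hn : (n : ℝ) * (t / (n + 1)) ≤ t := by
      rw [← mul_div_assoc, div_le_iff₀ (by positivity)]; nlinarith
    exact mul_le_mul_of_nonneg_right hn hS0
  calc quartic P k φ ^ n ≤ (K * Real.exp (t / (n + 1) * S)) ^ n := h1
    _ = K ^ n * Real.exp (n * (t / (n + 1)) * S) := h2
    _ ≤ K ^ n * Real.exp (t * S) := mul_le_mul_of_nonneg_left h3 (pow_nonneg hK0 n)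

/-- For `m₀² > 0`, `μ₀² > 0` every quartic moment density `V(φ)ⁿ·exp(−S^ε_{λ=0})` is integrable (polynomial times
Gaussian). [cite: Balaban1982Higgs1, (1.10) p.605] -/
theorem integrable_quartic_pow_mul_exp {m0sq mu0sq : ℝ} (hm : 0 < m0sq) (hmu : 0 < mu0sq)
    (C : HiggsLattice.ChargeData N) (E : ℝ) (n : ℕ) :
    Integrable fun Φ : HiggsLattice.VecField P k × HiggsLattice.ScalarField P k N =>
      quartic P k Φ.2 ^ n * Real.exp (-action C ⟨m0sq, 0, mu0sq, E⟩ Φ.1 Φ.2) := by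
  have hη : 0 < P.mesh k ^ P.d := pow_pos (P.mesh_pos k) _
  set Kq : ℝ := (Fintype.card (HiggsLattice.Site P k) * (2 / (((m0sq / 4) / (n + 1)) ^ 2 * P.mesh k ^ P.d))) ^ n
    with hKq
  have hKq0 : 0 ≤ Kq := by positivity
  have hmaj := (integrable_gauss (P := P) (k := k) (N := N) (a := P.mesh k ^ P.d * mu0sq / 2)
    (b := P.mesh k ^ P.d * (m0sq / 4)) (by positivity) (by positivity)).const_mul (Kq * Real.exp (-E))
  have hcont : Continuous fun Φ : HiggsLattice.VecField P k × HiggsLattice.ScalarField P k N =>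
      quartic P k Φ.2 ^ n * Real.exp (-action C ⟨m0sq, 0, mu0sq, E⟩ Φ.1 Φ.2) :=
    ((continuous_quartic.comp continuous_snd).pow n).mul (Real.continuous_exp.comp (continuous_action C _).neg)
  refine hmaj.mono' hcont.aestronglyMeasurable (Filter.Eventually.of_forall fun Φ => ?_)
  rw [Real.norm_eq_abs, abs_of_nonneg (mul_nonneg (pow_nonneg (quartic_nonneg _) _) (Real.exp_pos _).le)]
  have hV := quartic_pow_le_exp (P := P) (k := k) (t := m0sq / 4) (by positivity) n Φ.2
  have hS := action_lam_zero_ge C m0sq mu0sq E Φ.1 Φ.2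
  have hexp : (∏ bd : HiggsLattice.PBond P k, Real.exp (-(P.mesh k ^ P.d * mu0sq / 2) * (Φ.1 bd) ^ 2))
      * ∏ x : HiggsLattice.Site P k, Real.exp (-(P.mesh k ^ P.d * (m0sq / 4)) * ‖Φ.2 x‖ ^ 2)
      = Real.exp (-((∑ bd : HiggsLattice.PBond P k, P.mesh k ^ P.d * (mu0sq * (Φ.1 bd) ^ 2)) / 2)
          - (m0sq / 4) * ∑ x : HiggsLattice.Site P k, P.mesh k ^ P.d * ‖Φ.2 x‖ ^ 2) := by
    rw [← Real.exp_sum, ← Real.exp_sum, ← Real.exp_add]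
    congr 1
    rw [Finset.sum_div, Finset.mul_sum, sub_eq_add_neg, ← Finset.sum_neg_distrib, ← Finset.sum_neg_distrib]
    congr 1
    · exact Finset.sum_congr rfl fun b _ => by ring
    · exact Finset.sum_congr rfl fun x _ => by ring
  rw [hexp]
  have hm2 : ∑ x : HiggsLattice.Site P k, P.mesh k ^ P.d * (m0sq / 2 * ‖Φ.2 x‖ ^ 2)
      = (m0sq / 2) * ∑ x : HiggsLattice.Site P k, P.mesh k ^ P.d * ‖Φ.2 x‖ ^ 2 := by
    rw [Finset.mul_sum]; exact Finset.sum_congr rfl fun x _ => by ring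
  set G : ℝ := (∑ bd : HiggsLattice.PBond P k, P.mesh k ^ P.d * (mu0sq * (Φ.1 bd) ^ 2)) / 2
  set Q : ℝ := ∑ x : HiggsLattice.Site P k, P.mesh k ^ P.d * ‖Φ.2 x‖ ^ 2
  have hact : Real.exp (-action C ⟨m0sq, 0, mu0sq, E⟩ Φ.1 Φ.2) ≤ Real.exp (-(E + G + m0sq / 2 * Q)) := by
    rw [Real.exp_le_exp]; rw [hm2] at hS; linarith
  have hee : Real.exp (m0sq / 4 * Q) * Real.exp (-(E + G + m0sq / 2 * Q))
      = Real.exp (-E) * Real.exp (-G - m0sq / 4 * Q) := by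
    rw [← Real.exp_add, ← Real.exp_add]; congr 1; ring
  calc quartic P k Φ.2 ^ n * Real.exp (-action C ⟨m0sq, 0, mu0sq, E⟩ Φ.1 Φ.2)
      ≤ (Kq * Real.exp (m0sq / 4 * Q)) * Real.exp (-(E + G + m0sq / 2 * Q)) :=
        mul_le_mul hV hact (Real.exp_pos _).le (by positivity)
    _ = Kq * (Real.exp (m0sq / 4 * Q) * Real.exp (-(E + G + m0sq / 2 * Q))) := by ring
    _ = Kq * (Real.exp (-E) * Real.exp (-G - m0sq / 4 * Q)) := by rw [hee]
    _ = Kq * Real.exp (-E) * Real.exp (-G - m0sq / 4 * Q) := by ring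

/-- … hence the integrand of `M_n(λ)` is integrable for every `λ ≥ 0`. [cite: Balaban1982Higgs1, (1.10) p.605] -/
theorem integrable_momentFn_integrand {m0sq mu0sq : ℝ} (hm : 0 < m0sq) (hmu : 0 < mu0sq)
    (C : HiggsLattice.ChargeData N) (E : ℝ) (n : ℕ) {lam : ℝ} (hlam : 0 ≤ lam) :
    Integrable fun Φ : HiggsLattice.VecField P k × HiggsLattice.ScalarField P k N =>
      (-quartic P k Φ.2) ^ n * Real.exp (-(action C ⟨m0sq, 0, mu0sq, E⟩ Φ.1 Φ.2 + lam * quartic P k Φ.2)) := by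
  have hcont : Continuous fun Φ : HiggsLattice.VecField P k × HiggsLattice.ScalarField P k N =>
      (-quartic P k Φ.2) ^ n * Real.exp (-(action C ⟨m0sq, 0, mu0sq, E⟩ Φ.1 Φ.2 + lam * quartic P k Φ.2)) :=
    ((continuous_quartic.comp continuous_snd).neg.pow n).mul (Real.continuous_exp.comp
      ((continuous_action C _).add (continuous_const.mul (continuous_quartic.comp continuous_snd))).neg)
  refine (integrable_quartic_pow_mul_exp hm hmu C E n).mono' hcont.aestronglyMeasurable
    (Filter.Eventually.of_forall fun Φ => ?_)
  rw [Real.norm_eq_abs, abs_mul, abs_pow, abs_neg, abs_of_nonneg (quartic_nonneg _), abs_of_pos (Real.exp_pos _)]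
  refine mul_le_mul_of_nonneg_left ?_ (pow_nonneg (quartic_nonneg _) _)
  rw [Real.exp_le_exp]
  have := mul_nonneg hlam (quartic_nonneg (P := P) (k := k) Φ.2)
  linarith

/-- `|e^{−a} − e^{−b}| ≤ |a − b|` for `a, b ≥ 0` (`exp` is 1-Lipschitz on `(−∞, 0]`). [folklore] -/
private theorem abs_exp_neg_sub_exp_neg_le {a b : ℝ} (ha : 0 ≤ a) (hb : 0 ≤ b) :
    |Real.exp (-a) - Real.exp (-b)| ≤ |a - b| := by
  have key : ∀ {a b : ℝ}, 0 ≤ a → 0 ≤ b → Real.exp (-a) - Real.exp (-b) ≤ |a - b| := by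
    intro a b ha hb
    rcases le_or_gt a b with hab | hab
    · have h1 : Real.exp (-a) ≤ 1 := by rw [Real.exp_le_one_iff]; linarith
      have h2 : 1 - (b - a) ≤ Real.exp (-(b - a)) := by have := Real.add_one_le_exp (-(b - a)); linarith
      have h3 : Real.exp (-a) - Real.exp (-b) = Real.exp (-a) * (1 - Real.exp (-(b - a))) := by
        rw [mul_sub, mul_one, ← Real.exp_add]; congr 2; ring
      rw [h3, abs_of_nonpos (by linarith : a - b ≤ 0)]
      calc Real.exp (-a) * (1 - Real.exp (-(b - a))) ≤ 1 * (b - a) :=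
            mul_le_mul h1 (by linarith) (by have := Real.exp_le_one_iff.2 (by linarith : -(b - a) ≤ 0); linarith)
              zero_le_one
        _ = -(a - b) := by ring
    · have : Real.exp (-a) < Real.exp (-b) := Real.exp_lt_exp.2 (by linarith)
      have h0 : 0 ≤ |a - b| := abs_nonneg _
      linarith
  rw [abs_le]
  constructor
  · have := key hb ha
    rw [abs_sub_comm] at this
    linarith
  · exact key ha hb

/-- **`M_{n+1}` is the RIGHT derivative of `M_n` on `[0, ∞)`** (dominated convergence, bound `Vⁿ⁺¹e^{−S₀}`).
[cite: Balaban1982Higgs1, (1.13) p.606] -/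
theorem hasDerivWithinAt_momentFn {m0sq mu0sq : ℝ} (hm : 0 < m0sq) (hmu : 0 < mu0sq)
    (C : HiggsLattice.ChargeData N) (E : ℝ) (n : ℕ) {lam₀ : ℝ} (hlam₀ : 0 ≤ lam₀) :
    HasDerivWithinAt (momentFn P k N C m0sq mu0sq E n) (momentFn P k N C m0sq mu0sq E (n + 1) lam₀) (Ici 0) lam₀ := by
  rw [hasDerivWithinAt_iff_tendsto_slope]
  set S₀ : HiggsLattice.VecField P k × HiggsLattice.ScalarField P k N → ℝ :=
    fun Φ => action C ⟨m0sq, 0, mu0sq, E⟩ Φ.1 Φ.2 with hS₀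
  set F : ℝ → HiggsLattice.VecField P k × HiggsLattice.ScalarField P k N → ℝ :=
    fun lam Φ => (lam - lam₀)⁻¹ * ((-quartic P k Φ.2) ^ n * Real.exp (-(S₀ Φ + lam * quartic P k Φ.2))
      - (-quartic P k Φ.2) ^ n * Real.exp (-(S₀ Φ + lam₀ * quartic P k Φ.2))) with hF
  have hmem : ∀ᶠ lam in 𝓝[Ici (0 : ℝ) \ {lam₀}] lam₀, 0 ≤ lam ∧ lam ≠ lam₀ := by
    filter_upwards [self_mem_nhdsWithin] with lam hlam
    exact ⟨hlam.1, hlam.2⟩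
  have key : ∀ lam : ℝ, 0 ≤ lam → lam ≠ lam₀ →
      slope (momentFn P k N C m0sq mu0sq E n) lam₀ lam
        = ∫ Φ : HiggsLattice.VecField P k × HiggsLattice.ScalarField P k N, F lam Φ := by
    intro lam hlam hne
    rw [slope_def_field]
    unfold momentFn
    rw [← integral_sub (integrable_momentFn_integrand hm hmu C E n hlam)
      (integrable_momentFn_integrand hm hmu C E n hlam₀), div_eq_inv_mul, ← integral_const_mul]
  have hmeas : ∀ᶠ lam in 𝓝[Ici (0 : ℝ) \ {lam₀}] lam₀, AEStronglyMeasurable (F lam)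
      (volume : Measure (HiggsLattice.VecField P k × HiggsLattice.ScalarField P k N)) := by
    refine Filter.Eventually.of_forall fun lam => Continuous.aestronglyMeasurable ?_
    have hc0 : Continuous S₀ := continuous_action C _
    have hcq : Continuous fun Φ : HiggsLattice.VecField P k × HiggsLattice.ScalarField P k N => quartic P k Φ.2 :=
      continuous_quartic.comp continuous_snd
    have hterm : ∀ l : ℝ, Continuous fun Φ : HiggsLattice.VecField P k × HiggsLattice.ScalarField P k N =>
        (-quartic P k Φ.2) ^ n * Real.exp (-(S₀ Φ + l * quartic P k Φ.2)) :=
      fun l => (hcq.neg.pow n).mul (Real.continuous_exp.comp (hc0.add (continuous_const.mul hcq)).neg)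
    exact continuous_const.mul ((hterm lam).sub (hterm lam₀))
  have hbound : ∀ᶠ lam in 𝓝[Ici (0 : ℝ) \ {lam₀}] lam₀,
      ∀ᵐ Φ : HiggsLattice.VecField P k × HiggsLattice.ScalarField P k N,
        ‖F lam Φ‖ ≤ quartic P k Φ.2 ^ (n + 1) * Real.exp (-S₀ Φ) := by
    filter_upwards [hmem] with lam hlam
    refine Filter.Eventually.of_forall fun Φ => ?_
    have hV := quartic_nonneg (P := P) (k := k) Φ.2
    set V := quartic P k Φ.2 with hVdef
    have hfac : (-V) ^ n * Real.exp (-(S₀ Φ + lam * V)) - (-V) ^ n * Real.exp (-(S₀ Φ + lam₀ * V))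
        = (-V) ^ n * Real.exp (-S₀ Φ) * (Real.exp (-(lam * V)) - Real.exp (-(lam₀ * V))) := by
      rw [mul_sub, mul_assoc, mul_assoc, ← Real.exp_add, ← Real.exp_add]; congr 2 <;> ring
    simp only [hF]
    rw [hfac, Real.norm_eq_abs, abs_mul, abs_mul, abs_mul, abs_pow, abs_neg, abs_of_nonneg hV,
      abs_of_pos (Real.exp_pos _), abs_inv]
    have hne : lam - lam₀ ≠ 0 := sub_ne_zero.2 hlam.2
    have hpos : 0 < |lam - lam₀| := abs_pos.2 hne
    have hlip := abs_exp_neg_sub_exp_neg_le (mul_nonneg hlam.1 hV) (mul_nonneg hlam₀ hV)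
    have hlip' : |Real.exp (-(lam * V)) - Real.exp (-(lam₀ * V))| ≤ |lam - lam₀| * V := by
      calc |Real.exp (-(lam * V)) - Real.exp (-(lam₀ * V))| ≤ |lam * V - lam₀ * V| := hlip
        _ = |lam - lam₀| * V := by rw [← sub_mul, abs_mul, abs_of_nonneg hV]
    calc |lam - lam₀|⁻¹ * (V ^ n * Real.exp (-S₀ Φ) * |Real.exp (-(lam * V)) - Real.exp (-(lam₀ * V))|)
        ≤ |lam - lam₀|⁻¹ * (V ^ n * Real.exp (-S₀ Φ) * (|lam - lam₀| * V)) :=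
          mul_le_mul_of_nonneg_left (mul_le_mul_of_nonneg_left hlip'
            (mul_nonneg (pow_nonneg hV _) (Real.exp_pos _).le)) (inv_nonneg.2 (abs_nonneg _))
      _ = V ^ (n + 1) * Real.exp (-S₀ Φ) := by field_simp; ring
  have hlimpt : ∀ᵐ Φ : HiggsLattice.VecField P k × HiggsLattice.ScalarField P k N,
      Tendsto (fun lam => F lam Φ) (𝓝[Ici (0 : ℝ) \ {lam₀}] lam₀)
        (𝓝 ((-quartic P k Φ.2) ^ (n + 1) * Real.exp (-(S₀ Φ + lam₀ * quartic P k Φ.2)))) := by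
    refine Filter.Eventually.of_forall fun Φ => ?_
    set V := quartic P k Φ.2 with hVdef
    have hd : HasDerivAt (fun lam : ℝ => (-V) ^ n * Real.exp (-(S₀ Φ + lam * V)))
        ((-V) ^ (n + 1) * Real.exp (-(S₀ Φ + lam₀ * V))) lam₀ := by
      have h1 : HasDerivAt (fun lam : ℝ => -(S₀ Φ + lam * V)) (-(1 * V)) lam₀ :=
        (((hasDerivAt_id lam₀).mul_const V).const_add (S₀ Φ)).neg
      have h2 := (h1.exp).const_mul ((-V) ^ n)
      refine h2.congr_deriv ?_
      rw [pow_succ]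
      ring
    have ht := hd.tendsto_slope
    have hmono : 𝓝[Ici (0 : ℝ) \ {lam₀}] lam₀ ≤ 𝓝[≠] lam₀ := nhdsWithin_mono _ fun x hx => hx.2
    refine (ht.mono_left hmono).congr' ?_
    filter_upwards [hmem] with lam hlam
    rw [slope_def_field]
    simp only [hF, div_eq_inv_mul, hVdef]
  have hT := tendsto_integral_filter_of_dominated_convergence
    (fun Φ : HiggsLattice.VecField P k × HiggsLattice.ScalarField P k N => quartic P k Φ.2 ^ (n + 1) * Real.exp (-S₀ Φ))
    hmeas hbound (integrable_quartic_pow_mul_exp hm hmu C E (n + 1)) hlimpt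
  refine hT.congr' ?_
  filter_upwards [hmem] with lam hlam using (key lam hlam.1 hlam.2).symm

/-- `M_n` is differentiable on `[0, ∞)` with `derivWithin M_n [0,∞) = M_{n+1}` there.
[cite: Balaban1982Higgs1, (1.13) p.606] -/
theorem derivWithin_momentFn {m0sq mu0sq : ℝ} (hm : 0 < m0sq) (hmu : 0 < mu0sq)
    (C : HiggsLattice.ChargeData N) (E : ℝ) (n : ℕ) {lam₀ : ℝ} (hlam₀ : 0 ≤ lam₀) :
    derivWithin (momentFn P k N C m0sq mu0sq E n) (Ici 0) lam₀ = momentFn P k N C m0sq mu0sq E (n + 1) lam₀ :=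
  (hasDerivWithinAt_momentFn hm hmu C E n hlam₀).derivWithin (uniqueDiffOn_Ici 0 lam₀ hlam₀)

/-- **Every `M_n` — in particular `M₀ = Z` — is `C^∞` on `[0, ∞)`.** [cite: Balaban1982Higgs1, (1.13) p.606] -/
theorem contDiffOn_momentFn {m0sq mu0sq : ℝ} (hm : 0 < m0sq) (hmu : 0 < mu0sq)
    (C : HiggsLattice.ChargeData N) (E : ℝ) (n : ℕ) :
    ContDiffOn ℝ ∞ (momentFn P k N C m0sq mu0sq E n) (Ici 0) := by
  rw [contDiffOn_infty]
  intro m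
  induction m generalizing n with
  | zero =>
    exact contDiffOn_zero.2 fun lam hlam =>
      (hasDerivWithinAt_momentFn hm hmu C E n hlam).continuousWithinAt
  | succ m ih =>
    rw [show ((m + 1 : ℕ) : WithTop ℕ∞) = (m : WithTop ℕ∞) + 1 by push_cast; rfl,
      contDiffOn_succ_iff_derivWithin (uniqueDiffOn_Ici 0)]
    refine ⟨fun lam hlam => (hasDerivWithinAt_momentFn hm hmu C E n hlam).differentiableWithinAt, ?_, ?_⟩
    · intro h
      exact absurd h (by simp)
    · exact (ih (n + 1)).congr fun lam hlam => derivWithin_momentFn hm hmu C E n hlam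

/-- **`λ ↦ Z(λ)` is `C^∞` on `[0, ∞)`** (carrier level, bare mass fixed, `m₀² > 0`, `μ₀² > 0`): the one-sided reading
of ALL the `λ`-derivatives in (1.13) is well-defined. [cite: Balaban1982Higgs1, (1.13) p.606] -/
theorem contDiffOn_partitionFn_lam_Ici {m0sq mu0sq : ℝ} (hm : 0 < m0sq) (hmu : 0 < mu0sq)
    (C : HiggsLattice.ChargeData N) (E : ℝ) :
    ContDiffOn ℝ ∞ (fun lam => partitionFn P k N C ⟨m0sq, lam, mu0sq, E⟩) (Ici 0) :=
  (contDiffOn_momentFn hm hmu C E 0).congr fun lam _ => (momentFn_zero_eq C m0sq mu0sq E lam).symm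

/-- `Z(λ) > 0` on `[0, ∞)`. [cite: Balaban1982Higgs1, (1.10) p.605] -/
theorem partitionFn_pos_of_nonneg {m0sq mu0sq : ℝ} (hm : 0 < m0sq) (hmu : 0 < mu0sq)
    (C : HiggsLattice.ChargeData N) (E : ℝ) {lam : ℝ} (hlam : 0 ≤ lam) :
    0 < partitionFn P k N C ⟨m0sq, lam, mu0sq, E⟩ := by
  rcases hlam.eq_or_lt with h | h
  · rw [← h]; exact partitionFn_lam_zero_pos hm hmu C E
  · exact HiggsActionIntegrable.partitionFn_pos C ⟨m0sq, lam, mu0sq, E⟩ hmu h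

/-- **`λ ↦ log Z(λ)` is `C^∞` on `[0, ∞)`** — so every `iteratedDerivWithin β (λ ↦ log Z(λ)) (Set.Ici 0) 0` of the
one-sided reading of (1.13) is a genuine derivative. [cite: Balaban1982Higgs1, (1.13) p.606] -/
theorem contDiffOn_log_partitionFn_lam_Ici {m0sq mu0sq : ℝ} (hm : 0 < m0sq) (hmu : 0 < mu0sq)
    (C : HiggsLattice.ChargeData N) (E : ℝ) :
    ContDiffOn ℝ ∞ (fun lam => Real.log (partitionFn P k N C ⟨m0sq, lam, mu0sq, E⟩)) (Ici 0) :=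
  (contDiffOn_partitionFn_lam_Ici hm hmu C E).log fun _ hlam => (partitionFn_pos_of_nonneg hm hmu C E hlam).ne'

/-- **The right-sided iterated derivatives of `Z` at `λ = 0` ARE the signed quartic moments**:
`iteratedDerivWithin β (λ ↦ Z(λ)) [0,∞) 0 = ∫ (−V(φ))^β exp(−S^ε_{λ=0}) dA dφ` — the perturbation-expansion
coefficients the print means. [cite: Balaban1982Higgs1, (1.13) p.606] -/
theorem iteratedDerivWithin_partitionFn_lam_Ici {m0sq mu0sq : ℝ} (hm : 0 < m0sq) (hmu : 0 < mu0sq)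
    (C : HiggsLattice.ChargeData N) (E : ℝ) (β : ℕ) :
    iteratedDerivWithin β (fun lam => partitionFn P k N C ⟨m0sq, lam, mu0sq, E⟩) (Ici 0) 0
      = ∫ Φ : HiggsLattice.VecField P k × HiggsLattice.ScalarField P k N,
          (-quartic P k Φ.2) ^ β * Real.exp (-action C ⟨m0sq, 0, mu0sq, E⟩ Φ.1 Φ.2) := by
  -- on `[0, ∞)` the β-th iterated derivative within of `M₀` is `M_β`
  have hEq : ∀ β : ℕ, EqOn (iteratedDerivWithin β (fun lam => partitionFn P k N C ⟨m0sq, lam, mu0sq, E⟩) (Ici 0))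
      (momentFn P k N C m0sq mu0sq E β) (Ici 0) := by
    intro β
    induction β with
    | zero =>
      intro lam _
      rw [iteratedDerivWithin_zero, momentFn_zero_eq]
    | succ β ih =>
      intro lam hlam
      rw [iteratedDerivWithin_succ, derivWithin_congr ih (ih hlam), derivWithin_momentFn hm hmu C E β hlam]
  rw [hEq β Set.self_mem_Ici]
  unfold momentFn
  refine integral_congr_ae (Filter.Eventually.of_forall fun Φ => ?_)
  simp only [zero_mul, add_zero]

end AllOrders

/-! ## 6. (v1.2, append-only) By what r01's repaired `ModelData.e1R` (p331274) and the v1.0 `ModelData.e1` differ: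
exactly the `β ≥ 1` part of `e1R` — the whole `λ`-counterterm content of (1.13) -/

section Dictionary

variable (D : ModelData) (P : HiggsLattice.Params)

/-- **`E₁`, repaired minus two-sided**: for `N ≥ 1`, r01's one-sided `e1R P` minus the two-sided `e1 P` is EXACTLY
the `β ≥ 1` part of `e1R P`: `Σ_{1≤α+β≤n̄, β≥1} (α!β!)⁻¹ e^α λ^β ∂^α_{e′}|₀ ∂^β_{λ′,+}|₀ log Z` — every `λ`-counterterm
of (1.13) (the `β = 0` summands agree, r01's `e1R_term_beta_zero`; the `β ≥ 1` summands of `e1` vanish,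
`iteratedDeriv_logZ_lam_eq_zero`).  The paper-I twin of `B3Eq15OneSidedInteraction.interaction15R_sub_interaction15`.
[cite: Balaban1982Higgs1, (1.13) p.606] -/
theorem e1R_sub_e1 (hN : 1 ≤ D.N) :
    D.e1R P - D.e1 P = ∑ α ∈ Finset.range (D.nbar + 1), ∑ β ∈ Finset.range (D.nbar + 1),
      if 1 ≤ α + β ∧ α + β ≤ D.nbar ∧ 1 ≤ β then
        1 / ((Nat.factorial α : ℝ) * (Nat.factorial β : ℝ)) * D.C.e ^ α * D.lam ^ β *
          iteratedDeriv α (fun e' => iteratedDerivWithin β (fun lam' => D.logZ P e' lam') (Set.Ici 0) 0) 0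
      else 0 := by
  unfold ModelData.e1R ModelData.e1
  rw [← Finset.sum_sub_distrib]
  refine Finset.sum_congr rfl fun α _ => ?_
  rw [← Finset.sum_sub_distrib]
  refine Finset.sum_congr rfl fun β _ => ?_
  by_cases hβ : β = 0
  · subst hβ
    simp only [iteratedDerivWithin_zero, iteratedDeriv_zero, sub_self, Nat.le_zero, one_ne_zero, and_false, if_false]
  · have hβ1 : 1 ≤ β := Nat.one_le_iff_ne_zero.2 hβ
    have hin : (fun e' => iteratedDeriv β (fun lam' => D.logZ P e' lam') 0) = fun _ => (0 : ℝ) :=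
      funext fun e' => iteratedDeriv_logZ_lam_eq_zero D P hN e' hβ1
    rw [hin]
    by_cases hc : 1 ≤ α + β ∧ α + β ≤ D.nbar
    · rw [if_pos hc, if_pos hc, if_pos ⟨hc.1, hc.2, hβ1⟩]
      simp
    · rw [if_neg hc, if_neg hc, if_neg fun h => hc ⟨h.1, h.2.1⟩, sub_self]

/-- … so the two agree iff the `λ`-counterterm part of the repaired `E₁` vanishes. [cite: Balaban1982Higgs1, (1.13) p.606] -/
theorem e1R_eq_e1_iff (hN : 1 ≤ D.N) :
    D.e1R P = D.e1 P ↔ (∑ α ∈ Finset.range (D.nbar + 1), ∑ β ∈ Finset.range (D.nbar + 1),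
      if 1 ≤ α + β ∧ α + β ≤ D.nbar ∧ 1 ≤ β then
        1 / ((Nat.factorial α : ℝ) * (Nat.factorial β : ℝ)) * D.C.e ^ α * D.lam ^ β *
          iteratedDeriv α (fun e' => iteratedDerivWithin β (fun lam' => D.logZ P e' lam') (Set.Ici 0) 0) 0
      else 0) = 0 := by
  rw [← e1R_sub_e1 D P hN, sub_eq_zero]

end Dictionary

end Literature.MathematicalPhysics.QuantumFieldTheory.Balaban1983to89.B1Eq113OneSidedDerivatives
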